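import Summits.Ventures.LatticeQCDFlow.Scaling.SectorExactColdStartLaw

/-!
HONEST FRAMING: exact (Metropolis-corrected) sampling algorithms for lattice gauge theory; figures
of merit are autocorrelation/cost numbers at stated couplings and volumes; no continuum-physics
claim.

# SectorExactMixing — THE COLD-START LAW OF THE PERSISTENT HUB WITH SECTOR-EXACT FLOWS ON A GENERAL STATE SPACE:
# `d(n) ≤ 2((θ+K)/θ)·(1 − min{(1−θ)act/m, (hθ − (1−θ)t)/(K+θ)})ⁿ`, AT `θ = 2t/(2t+h)`:
# `d(n) ≤ 2(1 + K(2t+h)/(2t))·(1 − (th/(2t+h))·min{ac/m, 1/(K+1)})ⁿ` AND `t_mix(ε) ≤ ⌈ρ⁻¹·log(2(1 + K(2t+h)/(2t))/ε)⌉` —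
# `a = min_r min{1, cin_r/cout_r, cout_r/cin_r}` THE SECTOR-WEIGHT QUALITY; NO VOLUME, NO REGIME (lean-2 GEN-30, ours)

Venture-side (OURS).  Cell `lqcd-flow` (pub-lqcd), unit `pub-lqcd-lean-2-g30`, 2026-08-28.  Chapter Q (item 1 for sector-exact maps on a general
`S`), file 6 — the numbers.  `Scaling/SectorExactColdStartLaw` bounds `‖δ_x Pⁿ − π̃‖` by the stale mass plus the label chain's distance;
`Scaling/SectorExactStaleSet` bounds the first by `((θ+K)/θ)(1−λ)ⁿ`; the label chain is the Boolean star with laws `μ^B_k = (μ_k(A), μ_k(Aᶜ))`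
(`Scaling/SectorExactLabelChain`), whose acceptance floor is the sector-weight quality `a`, so `Scaling/BooleanStarColdStartLaw` bounds the second
by the same `((θ+K)/θ)(1−λ)ⁿ`.

## What is proved

* `boolLabel_basic` (the label laws are positive probability vectors, the label kernels row-stochastic and reversible),
  `boolLabel_accept_ge` (acceptance floor `a` for the label chain);
* **`sectorExact_worstTvDist_le`** — **`d(n) ≤ 2((θ+K)/θ)·(1 − min{(1−θ)act/m, ((1−t)w_0θ − (1−θ)t)/(K+θ)})ⁿ`** for: a finite `S`, a sector `A`
  charged by every law, `K` cold laws and a hot law (positive probability vectors), a hub list with multiplicities `≥ c`, entry maps preserving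
  `A` with `μ_{κ_r+1}(φ_r u) = c_r(u)μ_0(u)` (`c_r = cin_r` on `A`, `cout_r` off `A`, positive), exact hot redraws, `μ_k`-stationary row-stochastic
  SECTOR-CONFINED cold kernels, `0 ≤ t ≤ 1`, `w` a probability vector, `0 ≤ a ≤ min{1, cin_r/cout_r, cout_r/cin_r}`, `0 < θ ≤ 1`, `(1−θ)t ≤ (1−t)w_0θ`;
* **`sectorExact_worstTvDist_le_tuned`** (`θ = 2t/(2t+h)`, `0 < t < 1`, `w_0 > 0`) and **`sectorExact_mixingTime_le`**:
  **`t_mix(ε) ≤ ⌈ρ⁻¹·log(2(1 + K(2t+h)/(2t))/ε)⌉`**, `ρ = (th/(2t+h))·min{ac/m, 1/(K+1)}` (`a > 0`, `c ≥ 1`).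

Reading (no numerics implied): THE TOPOLOGICAL-FREEZING USE CASE OF ITEM 1 IS SETTLED — within-sector HMC (sector-confined, stationary) on `K`
cold replicas, a flow hub whose proposal reproduces each sector's shape and misses only the sector weights by the factor `a`, exact
accept/reject: the worst-start mixing time is `O((K + m/(ac))·(1/t + 1/h)·log(K/ε))`, with NOTHING of `|S|`, `π̃_min` or a regime; chapter O's
floors (`Θ((K/p) log K)` on the witness, which is the case `S = Bool`) show the order is right.  NOT CLAIMED: flows that are inexact within a
sector (the general persistent hub, still open); cold kernels that cross sectors; anything measured.  Literature grade (cell rule): OWN;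
nothing cited as a fact; no new bib keys.
-/

noncomputable section

open Finset Function
open Literature.Probability.MarkovChains

namespace Summit.Ventures.LatticeQCDFlow.Scaling

variable {S : Type*} [Fintype S] [DecidableEq S] {K m : ℕ} {μ : Fin (K + 1) → S → ℝ} {M : Fin (K + 1) → S → S → ℝ}
  {w : Fin (K + 1) → ℝ} {t : ℝ}

section Mixing
variable (κ : Fin m → Fin K) (φ : Fin m → Equiv.Perm S) (A : Finset S)

omit [Fintype S] in
/-- Two sectors as a Boolean label map `ℓ = [· ∈ A]`: the label form of the hypotheses. [ours] -/
theorem twoSector_asLabels (hφA : ∀ r u, φ r u ∈ A ↔ u ∈ A) {cin cout : Fin m → ℝ} (hcin : ∀ r, 0 < cin r) (hcout : ∀ r, 0 < cout r)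
    (hexact : ∀ r u, μ (κ r).succ (φ r u) = (if u ∈ A then cin r else cout r) * μ 0 u) :
    (∀ r u, (fun u => decide (u ∈ A)) (φ r u) = (fun u => decide (u ∈ A)) u)
    ∧ (∀ (r : Fin m) (b : Bool), 0 < (fun (r : Fin m) (b : Bool) => if b = true then cin r else cout r) r b)
    ∧ (∀ r u, μ (κ r).succ (φ r u)
        = (fun (r : Fin m) (b : Bool) => if b = true then cin r else cout r) r ((fun u => decide (u ∈ A)) u) * μ 0 u) := by
  refine ⟨fun r u => ?_, fun r b => ?_, fun r u => ?_⟩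
  · dsimp only; rw [decide_eq_decide]; exact hφA r u
  · dsimp only; split_ifs; exacts [hcin r, hcout r]
  · dsimp only; rw [hexact r u]; simp only [decide_eq_true_eq]

omit [Fintype S] in
/-- The label laws are probability vectors and the label kernels (exact hot redraw, identity cold) are row-stochastic and reversible. [ours] -/
theorem boolLabel_basic [Fintype S] (hμ1 : ∀ k, ∑ u, μ k u = 1) {μB : Fin (K + 1) → Bool → ℝ}
    (hμB : ∀ k b, μB k b = ∑ u ∈ univ.filter (fun u => decide (u ∈ A) = b), μ k u) (hμB0 : ∀ k b, 0 < μB k b) :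
    (∀ k, ∑ b, μB k b = 1)
    ∧ (∀ k, IsRowStochastic ((fun (k : Fin (K + 1)) (u v : Bool) => if k = 0 then μB 0 v else (if u = v then (1 : ℝ) else 0)) k))
    ∧ (∀ k, DetailedBalance (μB k) ((fun (k : Fin (K + 1)) (u v : Bool) => if k = 0 then μB 0 v else (if u = v then (1 : ℝ) else 0)) k)) := by
  have h1 : ∀ k, ∑ b, μB k b = 1 := by
    intro k
    simp_rw [hμB]
    rw [Finset.sum_fiberwise univ (fun u : S => decide (u ∈ A)) (fun u => μ k u)]
    exact hμ1 k
  refine ⟨h1, fun k => ⟨fun u v => ?_, fun u => ?_⟩, fun k => ?_⟩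
  · dsimp only; split_ifs; exacts [(hμB0 0 v).le, zero_le_one, le_rfl]
  · dsimp only
    by_cases hk : k = 0
    · simp only [hk, if_true]; exact h1 0
    · simp only [hk, if_false]; rw [Finset.sum_ite_eq univ u, if_pos (mem_univ _)]
  · intro u v
    dsimp only
    by_cases hk : k = 0
    · subst hk; simp only [if_true]; ring
    · simp only [hk, if_false]
      by_cases huv : u = v
      · subst huv; rfl
      · rw [if_neg huv, if_neg (Ne.symm huv), mul_zero, mul_zero]

/-- **The label chain's acceptance floor is the sector-weight quality:** for `s_0 ≠ s_l`,
`a ≤ min{1, π̃_B(y^B_r s)/π̃_B(s)}` whenever `a ≤ min{1, cin_r/cout_r, cout_r/cin_r}`. [ours] -/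
theorem boolLabel_accept_ge (hφA : ∀ r u, φ r u ∈ A ↔ u ∈ A) {cin cout : Fin m → ℝ} (hcin : ∀ r, 0 < cin r) (hcout : ∀ r, 0 < cout r)
    (hexact : ∀ r u, μ (κ r).succ (φ r u) = (if u ∈ A then cin r else cout r) * μ 0 u)
    {μB : Fin (K + 1) → Bool → ℝ} (hμB : ∀ k b, μB k b = ∑ u ∈ univ.filter (fun u => decide (u ∈ A) = b), μ k u)
    (hμB0 : ∀ k b, 0 < μB k b) {a : ℝ} (ha : ∀ r, a ≤ min 1 (min (cin r / cout r) (cout r / cin r)))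
    (r : Fin m) (s : Fin (K + 1) → Bool) (_hs : s 0 ≠ s (κ r).succ) :
    a ≤ min 1 (tensorFun μB (edgeFlowSwap (Equiv.refl Bool) 0 (κ r).succ s) / tensorFun μB s) := by
  obtain ⟨hφℓ, hcL, hexact'⟩ := twoSector_asLabels κ φ A hφA hcin hcout hexact
  rw [boolLabel_accept_eq κ φ (fun u => decide (u ∈ A)) hφℓ hcL hexact' hμB hμB0 r s]
  have h := ha r
  have h1 : a ≤ 1 := h.trans (min_le_left _ _)
  have h2 : a ≤ cin r / cout r := h.trans ((min_le_right _ _).trans (min_le_left _ _))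
  have h3 : a ≤ cout r / cin r := h.trans ((min_le_right _ _).trans (min_le_right _ _))
  refine le_min h1 ?_
  by_cases hz0 : s 0 = true <;> by_cases hzl : s (κ r).succ = true
  · rw [if_pos hz0, if_pos hzl, div_self (hcin r).ne']; exact h1
  · rw [if_pos hz0, if_neg hzl]; exact h2
  · rw [if_neg hz0, if_pos hzl]; exact h3
  · rw [if_neg hz0, if_neg hzl, div_self (hcout r).ne']; exact h1

/-- **THE COLD-START LAW WITH SECTOR-EXACT FLOWS, GENERAL `S`:**
**`d(n) ≤ 2((θ+K)/θ)·(1 − min{(1−θ)·a·c·t/m, ((1−t)w_0·θ − (1−θ)t)/(K+θ)})ⁿ`** — no volume, no regime, polynomial in `K`. [ours] -/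
theorem sectorExact_worstTvDist_le (hm : 1 ≤ m) (ht0 : 0 ≤ t) (ht1 : t ≤ 1) (hw0 : ∀ k, 0 ≤ w k) (hw1 : ∑ k, w k = 1)
    (hμ : ∀ k x, 0 < μ k x) (hμ1 : ∀ k, ∑ u, μ k u = 1) (hφA : ∀ r u, φ r u ∈ A ↔ u ∈ A) {cin cout : Fin m → ℝ}
    (hcin : ∀ r, 0 < cin r) (hcout : ∀ r, 0 < cout r) (hexact : ∀ r u, μ (κ r).succ (φ r u) = (if u ∈ A then cin r else cout r) * μ 0 u)
    (hM : ∀ k, IsRowStochastic (M k)) (hM0 : ∀ u v, M 0 u v = μ 0 v)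
    (hstat : ∀ k : Fin (K + 1), k ≠ 0 → ∀ v, ∑ u, μ k u * M k u v = μ k v)
    (hconf : ∀ k : Fin (K + 1), k ≠ 0 → ∀ u v, ¬(u ∈ A ↔ v ∈ A) → M k u v = 0)
    (hA : ∀ k b, 0 < ∑ u ∈ univ.filter (fun u => decide (u ∈ A) = b), μ k u)
    {a θ : ℝ} (ha0 : 0 ≤ a) (ha : ∀ r, a ≤ min 1 (min (cin r / cout r) (cout r / cin r))) (hθ0 : 0 < θ) (hθ1 : θ ≤ 1)
    (hreg : (1 - θ) * t ≤ (1 - t) * w 0 * θ)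
    {c : ℕ} (hc : ∀ p' : Fin K, c ≤ (univ.filter (fun r : Fin m => κ r = p')).card) (n : ℕ) :
    worstTvDist (fun y z : Fin (K + 1) → S =>
        t * ptGraphSwap μ (fun r : Fin m => (((0 : Fin (K + 1)), (κ r).succ) : Fin (K + 1) × Fin (K + 1))) φ y z
          + (1 - t) * prodKernel w M y z) (tensorFun μ) n
      ≤ 2 * ((θ + K) / θ) * (1 - min ((1 - θ) * a * c * t / m) (((1 - t) * w 0 * θ - (1 - θ) * t) / (K + θ))) ^ n := by
  set μB : Fin (K + 1) → Bool → ℝ := fun k b => ∑ u ∈ univ.filter (fun u => decide (u ∈ A) = b), μ k u with hμBd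
  have hμB : ∀ k b, μB k b = ∑ u ∈ univ.filter (fun u => decide (u ∈ A) = b), μ k u := fun _ _ => rfl
  have hμB0 : ∀ k b, 0 < μB k b := hA
  obtain ⟨hμB1, hMB, hMBrev⟩ := boolLabel_basic A hμ1 hμB hμB0
  set lam := min ((1 - θ) * a * c * t / m) (((1 - t) * w 0 * θ - (1 - θ) * t) / (K + θ)) with hlam
  have hαrfl : ∀ r z, (fun r z => min 1 (tensorFun μ (edgeFlowSwap (φ r) 0 (κ r).succ z) / tensorFun μ z)) r z
      = min 1 (tensorFun μ (edgeFlowSwap (φ r) 0 (κ r).succ z) / tensorFun μ z) := fun _ _ => rfl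
  -- the two sectors as a Boolean label map
  obtain ⟨hφℓ, hcL, hexact'⟩ := twoSector_asLabels κ φ A hφA hcin hcout hexact
  have hconf' : ∀ k : Fin (K + 1), k ≠ 0 → ∀ u v : S, (fun u => decide (u ∈ A)) u ≠ (fun u => decide (u ∈ A)) v → M k u v = 0 :=
    fun k hk u v huv => hconf k hk u v (fun h => huv (by dsimp only; rw [decide_eq_decide]; exact h))
  have ha' : ∀ (r : Fin m) (b b' : Bool), a ≤ min 1 ((fun (r : Fin m) (b : Bool) => if b = true then cin r else cout r) r b
      / (fun (r : Fin m) (b : Bool) => if b = true then cin r else cout r) r b') := by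
    intro r b b'
    dsimp only
    have h := ha r
    have h1 : a ≤ 1 := h.trans (min_le_left _ _)
    have h2 : a ≤ cin r / cout r := h.trans ((min_le_right _ _).trans (min_le_left _ _))
    have h3 : a ≤ cout r / cin r := h.trans ((min_le_right _ _).trans (min_le_right _ _))
    refine le_min h1 ?_
    cases b <;> cases b' <;> simp only [Bool.false_eq_true, if_true, if_false]
    · rw [div_self (hcout r).ne']; exact h1
    · exact h3
    · exact h2
    · rw [div_self (hcin r).ne']; exact h1
  have haα : ∀ r z, a ≤ (fun r z => min 1 (tensorFun μ (edgeFlowSwap (φ r) 0 (κ r).succ z) / tensorFun μ z)) r z :=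
    fun r z => sectorExact_accept_ge κ φ (fun u => decide (u ∈ A)) hμ hφℓ hcL hexact' hαrfl ha' r z
  -- the Boolean star's law for the labels
  have hB := boolStar_worstTvDist_le κ (μ := μB)
    (M := fun (k : Fin (K + 1)) (u v : Bool) => if k = 0 then μB 0 v else (if u = v then (1 : ℝ) else 0)) (w := w)
    hm ht0 ht1 hw0 hw1 hμB0 hμB1 hMB hMBrev (fun u v => by simp) hθ0 hθ1 ha0 hreg hc
    (fun r s hs => boolLabel_accept_ge κ φ A hφA hcin hcout hexact hμB hμB0 ha r s hs) n
  have hnonneg : 0 ≤ 2 * ((θ + K) / θ) * (1 - lam) ^ n := by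
    have : 0 ≤ (θ + K) / θ * (1 - lam) ^ n := (worstTvDist_nonneg _ _ n).trans hB
    linarith
  refine Real.iSup_le (fun x => ?_) hnonneg
  have hdec := sectorExact_tvDist_le κ φ (fun u => decide (u ∈ A)) hm ht0 ht1 hw0 hw1 hμ hφℓ hcL hexact' hM hM0 hstat hconf' hμB hμB0
    (Ph := fun a b => ∑ r : Fin m, t / m *
        ((fun r a => (fun r z => min 1 (tensorFun μ (edgeFlowSwap (φ r) 0 (κ r).succ z) / tensorFun μ z)) r a.1) r a
            * (if b.1 = edgeFlowSwap (φ r) 0 (κ r).succ a.1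
            ∧ b.2 = a.2.image (Equiv.swap (0 : Fin (K + 1)) (κ r).succ) then (1 : ℝ) else 0)
          + ((fun r z => min 1 (tensorFun μ (edgeFlowSwap (φ r) 0 (κ r).succ z) / tensorFun μ z)) r a.1
              - (fun r a => (fun r z => min 1 (tensorFun μ (edgeFlowSwap (φ r) 0 (κ r).succ z) / tensorFun μ z)) r a.1) r a)
            * (if b.1 = edgeFlowSwap (φ r) 0 (κ r).succ a.1
              ∧ b.2 = (fun (_ : Fin m) (D : Finset (Fin (K + 1))) => D) r a.2 then (1 : ℝ) else 0)
          + (1 - (fun r z => min 1 (tensorFun μ (edgeFlowSwap (φ r) 0 (κ r).succ z) / tensorFun μ z)) r a.1)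
            * (if b.1 = a.1 ∧ b.2 = (fun (_ : Fin m) (D : Finset (Fin (K + 1))) => D) r a.2 then (1 : ℝ) else 0))
      + (1 - t) * ∑ k : Fin (K + 1), w k * (coordKernel M k a.1 b.1
          * (if b.2 = (if k = 0 then a.2.erase 0 else a.2) then (1 : ℝ) else 0)))
    (fun _ _ => rfl) x n
  have hstale := sectorAug_stale_le κ φ hm ht0 ht1 hw0 hw1 hM hμ hαrfl ha0 haα hθ0 hθ1 hreg hc
    (Ph := fun a b => ∑ r : Fin m, t / m *
        ((fun r a => (fun r z => min 1 (tensorFun μ (edgeFlowSwap (φ r) 0 (κ r).succ z) / tensorFun μ z)) r a.1) r a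
            * (if b.1 = edgeFlowSwap (φ r) 0 (κ r).succ a.1
            ∧ b.2 = a.2.image (Equiv.swap (0 : Fin (K + 1)) (κ r).succ) then (1 : ℝ) else 0)
          + ((fun r z => min 1 (tensorFun μ (edgeFlowSwap (φ r) 0 (κ r).succ z) / tensorFun μ z)) r a.1
              - (fun r a => (fun r z => min 1 (tensorFun μ (edgeFlowSwap (φ r) 0 (κ r).succ z) / tensorFun μ z)) r a.1) r a)
            * (if b.1 = edgeFlowSwap (φ r) 0 (κ r).succ a.1
              ∧ b.2 = (fun (_ : Fin m) (D : Finset (Fin (K + 1))) => D) r a.2 then (1 : ℝ) else 0)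
          + (1 - (fun r z => min 1 (tensorFun μ (edgeFlowSwap (φ r) 0 (κ r).succ z) / tensorFun μ z)) r a.1)
            * (if b.1 = a.1 ∧ b.2 = (fun (_ : Fin m) (D : Finset (Fin (K + 1))) => D) r a.2 then (1 : ℝ) else 0))
      + (1 - t) * ∑ k : Fin (K + 1), w k * (coordKernel M k a.1 b.1
          * (if b.2 = (if k = 0 then a.2.erase 0 else a.2) then (1 : ℝ) else 0)))
    (fun _ _ => rfl) x n
  have hlabel := (tvDist_single_le_worstTvDist _ _ n (fun k => decide (x k ∈ A))).trans hB
  calc _ ≤ _ := hdec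
    _ ≤ (θ + K) / θ * (1 - lam) ^ n + (θ + K) / θ * (1 - lam) ^ n := add_le_add hstale hlabel
    _ = 2 * ((θ + K) / θ) * (1 - lam) ^ n := by ring

/-- **THE TUNED LAW** (`θ = 2t/(2t+h)`, `h = (1−t)w_0`; `0 < t < 1`, `w_0 > 0`):
**`d(n) ≤ 2(1 + K(2t+h)/(2t))·(1 − (th/(2t+h))·min{ac/m, 1/(K+1)})ⁿ`**. [ours] -/
theorem sectorExact_worstTvDist_le_tuned (hm : 1 ≤ m) (ht0 : 0 < t) (ht1 : t < 1) (hw0 : ∀ k, 0 ≤ w k) (hw00 : 0 < w 0)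
    (hw1 : ∑ k, w k = 1) (hμ : ∀ k x, 0 < μ k x) (hμ1 : ∀ k, ∑ u, μ k u = 1) (hφA : ∀ r u, φ r u ∈ A ↔ u ∈ A) {cin cout : Fin m → ℝ}
    (hcin : ∀ r, 0 < cin r) (hcout : ∀ r, 0 < cout r) (hexact : ∀ r u, μ (κ r).succ (φ r u) = (if u ∈ A then cin r else cout r) * μ 0 u)
    (hM : ∀ k, IsRowStochastic (M k)) (hM0 : ∀ u v, M 0 u v = μ 0 v)
    (hstat : ∀ k : Fin (K + 1), k ≠ 0 → ∀ v, ∑ u, μ k u * M k u v = μ k v)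
    (hconf : ∀ k : Fin (K + 1), k ≠ 0 → ∀ u v, ¬(u ∈ A ↔ v ∈ A) → M k u v = 0)
    (hA : ∀ k b, 0 < ∑ u ∈ univ.filter (fun u => decide (u ∈ A) = b), μ k u)
    {a : ℝ} (ha0 : 0 ≤ a) (ha : ∀ r, a ≤ min 1 (min (cin r / cout r) (cout r / cin r)))
    {c : ℕ} (hc : ∀ p' : Fin K, c ≤ (univ.filter (fun r : Fin m => κ r = p')).card) (n : ℕ) :
    worstTvDist (fun y z : Fin (K + 1) → S =>
        t * ptGraphSwap μ (fun r : Fin m => (((0 : Fin (K + 1)), (κ r).succ) : Fin (K + 1) × Fin (K + 1))) φ y z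
          + (1 - t) * prodKernel w M y z) (tensorFun μ) n
      ≤ 2 * (1 + K * (2 * t + (1 - t) * w 0) / (2 * t))
        * (1 - t * ((1 - t) * w 0) / (2 * t + (1 - t) * w 0) * min (a * c / m) (1 / (K + 1))) ^ n := by
  set h := (1 - t) * w 0 with hh
  have hh0 : 0 < h := mul_pos (by linarith) hw00
  set θ := 2 * t / (2 * t + h) with hθ
  have hθ0 : 0 < θ := by positivity
  have hθ1 : θ ≤ 1 := by rw [hθ, div_le_one (by positivity)]; linarith
  have h1θ : 1 - θ = h / (2 * t + h) := by rw [hθ]; field_simp; ring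
  have hreg : (1 - θ) * t ≤ (1 - t) * w 0 * θ := by
    rw [h1θ, ← hh, hθ]
    rw [div_mul_eq_mul_div, mul_div_assoc', div_le_div_iff_of_pos_right (by positivity)]
    nlinarith [mul_pos ht0 hh0]
  have hmain := sectorExact_worstTvDist_le κ φ A hm ht0.le ht1.le hw0 hw1 hμ hμ1 hφA hcin hcout hexact hM hM0 hstat hconf hA ha0 ha
    hθ0 hθ1 hreg hc n
  have hmpos : (0 : ℝ) < m := Nat.cast_pos.mpr (by omega)
  have hrate : t * h / (2 * t + h) * min (a * c / m) (1 / (K + 1))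
      ≤ min ((1 - θ) * a * c * t / m) (((1 - t) * w 0 * θ - (1 - θ) * t) / (K + θ)) := by
    refine le_min ?_ ?_
    · calc t * h / (2 * t + h) * min (a * c / m) (1 / (K + 1)) ≤ t * h / (2 * t + h) * (a * c / m) :=
            mul_le_mul_of_nonneg_left (min_le_left _ _) (by positivity)
        _ = (1 - θ) * a * c * t / m := by rw [h1θ]; ring
    · calc t * h / (2 * t + h) * min (a * c / m) (1 / (K + 1)) ≤ t * h / (2 * t + h) * (1 / (K + 1)) :=
            mul_le_mul_of_nonneg_left (min_le_right _ _) (by positivity)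
        _ ≤ t * h / (2 * t + h) * (1 / (K + θ)) := by gcongr
        _ = ((1 - t) * w 0 * θ - (1 - θ) * t) / (K + θ) := by rw [← hh, h1θ, hθ]; field_simp; ring
  have hconst : (θ + K) / θ = 1 + K * (2 * t + h) / (2 * t) := by rw [hθ]; field_simp
  have hbase0 : 0 ≤ 1 - min ((1 - θ) * a * c * t / m) (((1 - t) * w 0 * θ - (1 - θ) * t) / (K + θ)) := by
    have h2 : min ((1 - θ) * a * c * t / m) (((1 - t) * w 0 * θ - (1 - θ) * t) / (K + θ))
        ≤ ((1 - t) * w 0 * θ - (1 - θ) * t) / (K + θ) := min_le_right _ _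
    have h3 : ((1 - t) * w 0 * θ - (1 - θ) * t) / (K + θ) ≤ 1 := by
      rw [div_le_one (by positivity)]
      have hw01 : w 0 ≤ 1 := by
        calc w 0 ≤ ∑ k, w k := Finset.single_le_sum (fun k _ => hw0 k) (mem_univ 0)
          _ = 1 := hw1
      nlinarith [mul_nonneg (sub_nonneg.mpr ht1.le) (hw0 0), mul_nonneg (sub_nonneg.mpr hθ1) ht0.le, hθ0.le,
        mul_le_mul_of_nonneg_left hw01 (sub_nonneg.mpr ht1.le), Nat.cast_nonneg (α := ℝ) K]
    linarith
  calc _ ≤ 2 * ((θ + K) / θ) * (1 - min ((1 - θ) * a * c * t / m) (((1 - t) * w 0 * θ - (1 - θ) * t) / (K + θ))) ^ n := hmain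
    _ ≤ 2 * (1 + K * (2 * t + h) / (2 * t)) * (1 - t * h / (2 * t + h) * min (a * c / m) (1 / (K + 1))) ^ n := by
        rw [hconst]
        exact mul_le_mul_of_nonneg_left (pow_le_pow_left₀ hbase0 (by linarith [hrate]) n) (by positivity)

/-- **THE MIXING TIME WITH SECTOR-EXACT FLOWS:** `ρ = (th/(2t+h))·min{ac/m, 1/(K+1)}` (`h = (1−t)w_0`, `a > 0`, `c ≥ 1`):
**`t_mix(ε) ≤ ⌈ρ⁻¹·log(2(1 + K(2t+h)/(2t))/ε)⌉`** — `O((K + m/(ac))·(1/t + 1/h)·log(K/ε))`, free of `|S|` and `π̃_min`. [ours] -/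
theorem sectorExact_mixingTime_le (hm : 1 ≤ m) (ht0 : 0 < t) (ht1 : t < 1) (hw0 : ∀ k, 0 ≤ w k) (hw00 : 0 < w 0)
    (hw1 : ∑ k, w k = 1) (hμ : ∀ k x, 0 < μ k x) (hμ1 : ∀ k, ∑ u, μ k u = 1) (hφA : ∀ r u, φ r u ∈ A ↔ u ∈ A) {cin cout : Fin m → ℝ}
    (hcin : ∀ r, 0 < cin r) (hcout : ∀ r, 0 < cout r) (hexact : ∀ r u, μ (κ r).succ (φ r u) = (if u ∈ A then cin r else cout r) * μ 0 u)
    (hM : ∀ k, IsRowStochastic (M k)) (hM0 : ∀ u v, M 0 u v = μ 0 v)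
    (hstat : ∀ k : Fin (K + 1), k ≠ 0 → ∀ v, ∑ u, μ k u * M k u v = μ k v)
    (hconf : ∀ k : Fin (K + 1), k ≠ 0 → ∀ u v, ¬(u ∈ A ↔ v ∈ A) → M k u v = 0)
    (hA : ∀ k b, 0 < ∑ u ∈ univ.filter (fun u => decide (u ∈ A) = b), μ k u)
    {a : ℝ} (ha0 : 0 < a) (ha : ∀ r, a ≤ min 1 (min (cin r / cout r) (cout r / cin r)))
    {c : ℕ} (hc1 : 1 ≤ c) (hc : ∀ p' : Fin K, c ≤ (univ.filter (fun r : Fin m => κ r = p')).card) {ε : ℝ} (hε : 0 < ε) :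
    mixingTime (fun y z : Fin (K + 1) → S =>
        t * ptGraphSwap μ (fun r : Fin m => (((0 : Fin (K + 1)), (κ r).succ) : Fin (K + 1) × Fin (K + 1))) φ y z
          + (1 - t) * prodKernel w M y z) (tensorFun μ) ε
      ≤ ⌈1 / (t * ((1 - t) * w 0) / (2 * t + (1 - t) * w 0) * min (a * c / m) (1 / (K + 1)))
          * Real.log (2 * (1 + K * (2 * t + (1 - t) * w 0) / (2 * t)) / ε)⌉₊ := by
  set h := (1 - t) * w 0 with hh
  have hh0 : 0 < h := mul_pos (by linarith) hw00
  have hmpos : (0 : ℝ) < m := Nat.cast_pos.mpr (by omega)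
  set ρ := t * h / (2 * t + h) * min (a * c / m) (1 / (K + 1)) with hρ
  have hρ0 : 0 < ρ := by
    have : 0 < min (a * c / (m : ℝ)) (1 / ((K : ℝ) + 1)) := lt_min (by positivity) (by positivity)
    positivity
  have hρ1 : ρ ≤ 1 := by
    have h1 : t * h / (2 * t + h) ≤ 1 := by rw [div_le_one (by positivity)]; nlinarith [mul_pos ht0 hh0]
    have h2 : min (a * c / (m : ℝ)) (1 / ((K : ℝ) + 1)) ≤ 1 := (min_le_right _ _).trans (by
      rw [div_le_one (by positivity)]; linarith [Nat.cast_nonneg (α := ℝ) K])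
    have h3 : 0 ≤ min (a * c / (m : ℝ)) (1 / ((K : ℝ) + 1)) := le_min (by positivity) (by positivity)
    calc ρ ≤ 1 * 1 := mul_le_mul h1 h2 h3 zero_le_one
      _ = 1 := one_mul 1
  set n : ℕ := ⌈1 / ρ * Real.log (2 * (1 + K * (2 * t + h) / (2 * t)) / ε)⌉₊ with hn
  refine mixingTime_le _ _ ((sectorExact_worstTvDist_le_tuned κ φ A hm ht0 ht1 hw0 hw00 hw1 hμ hμ1 hφA hcin hcout hexact hM hM0 hstat
    hconf hA ha0.le ha hc n).trans ?_)
  exact geom_le_of_ge_log hρ0 hρ1 (by positivity) hε (Nat.le_ceil _)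

end Mixing

end Summit.Ventures.LatticeQCDFlow.Scaling

end
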